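import Summits.HodgeConjecture.HodgeConjecture.Theorems.A3Liu418S34ClauseOneOfGS
import Literature.AlgebraicGeometry.ShimuraVarieties.UnitaryShimuraCurveEmbeddingInjectiveOfFrameStabiliser
import Literature.AlgebraicGeometry.ShimuraVarieties.UnitaryShimuraCurveRecordOfEmbedding
import HarnessLib

/-!
# Line `a3_liu418`, residual `stub_S34`, clause (1) WITHOUT the GS-3 fact: the GS seesaw source over the curve records CONSTRUCTED from the
# embedding (road (ii) «embedded-curve descent»)

Cell `hodgecm-mathlib` (D-0151), fan A, crux `HLiu418` (stmt-HodgeConjecture-24832), edition v20 of the GS programme.  Sibling of ★ F6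
`Theorems/A3Liu418S34ClauseOneOfGS.lean` (p689695), which it imports and leaves byte-identical.  THEOREMS ONLY: no definition, no instance, no
named fact, no `sorry`.  HC_CM is NOT proved by this file (proved only modulo the printed citations); after this file the clause-(1) head no
longer consumes the named fact GS-3 `exists_recordSystemGS` — its remaining hypotheses are `hMR` (III-8′, now ★ discharged upstream),
`hU7 : heckeTranslate_definedOver` and `h : exists_recordSystem` (the rank-3 canonical model, [Deligne1979ShimuraVarieties] 2.2.5 / Cor. 2.7.21).

* §3 `exists_seesawSourceGS_etPull_comp_ne_zero_of_curveRecords` — F6's head with `hGS3` replaced by the hypothesis `hcurve`: for every `2 + 1`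
  frame `(J⋆, J⊥, B)` of `V.Hm` with `J⊥` totally positive, SOME source threshold `K₀⋆` mapping into `K_f(3)` carries a curve record system with
  u1/u4/u2 relative to THE rank-3 record `recordOf h V h4`; proof = F6's (F3 target side → frame `B := γ₁⁻¹B₀` → `hcurve` → ★ §2a
  `schemeBettiPullAlong_towerHomGS_map_ne_zero` → spine); `curveRecords_of_exists_recordSystemGS` recovers F6's input from ★ `gsFace_cluster`.
* §4 `gsFace_isUnit_det` (`det J⋆ ≠ 0` from a (1,1) frame, ★ `det_formCongr`) and **`curveRecords_of_head`**: `hcurve` from the road-(ii) theorem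
  ★ `UnitaryCanonicalModel.exists_recordSystemGS_of_recordSystem` (`ShimuraVarieties/UnitaryShimuraCurveRecordOfEmbedding.lean`: the curve's
  canonical model BUILT from its embedding into the surface — descended tower, complex points, pieces, u1/u4/u2 ★) at `recordOf h V h4`:
  `hJ` (★ `isHermitian_subform_left`), `hdet`, the (1,1) frame (★ `gsFace_frame`), the injectivity depth `m₀` (★
  `ShimuraSetGS.embPoints_injective_of_le_levelB_holds`, [Deligne1971TravauxShimura] Prop. 1.15), the source threshold
  `K₀⋆ := K⋆(3) ⊓ φGS⁻¹(K_B((m₀+3)!)) ⊓ φGS⁻¹(K_f(3))` (★ `OpenCompactSubgroup.restrict`), the field pin (★ `HComp.RecordSystem.exists_pieces_fieldRange`),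
  and the positivity of `J⊥` at `ι₁`.
* §5 **`exists_seesawSourceGS_etPull_comp_ne_zero'`** — F6's head statement MINUS the binder `hGS3`, nothing else changed; consumed by the GS-8
  edition (`Theorems/A3Liu418S34OfGS.lean`, primed heads) so that registry v20 drops `stub_GS3`.

References: [Liu2021] Y. Liu, arXiv:2102.11518 = Camb. J. Math. 9 (2021): Thm. 4.15 proof p. 51 (FJcycle.tex l. 2185–2213) with fn. 9;
[Deligne1971TravauxShimura] Prop. 1.15 p. 132, Cor. 5.7; [Deligne1979ShimuraVarieties] Thm. 2.7.20, Cor. 2.7.21, 2.2.5–2.2.6;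
[Milne2005ShimuraVarieties] Lemma 5.13 p. 57, Thm. 5.16 p. 59, Thm. 13.6 p. 118; [MurtyRamakrishnan1992] Prop. 6 (through Liu2021 fn. 9); [Kudla1984] §1.
-/

set_option autoImplicit false

noncomputable section

namespace Summit.HodgeConjecture.CorCM.Lines.A3Liu418


open CategoryTheory CategoryTheory.Limits AlgebraicGeometry NumberField Function MulAction
open scoped TensorProduct Matrix ComplexOrder
open Literature.AlgebraicGeometry.Motives
open Literature.AlgebraicGeometry.ShimuraVarieties Literature.AlgebraicGeometry.ShimuraVarieties.UnitaryCanonicalModel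
open Literature.NumberTheory.Automorphic Literature.NumberTheory.Automorphic.UnitaryGroup
open Literature.NumberTheory.Automorphic.Liu2021 Literature.NumberTheory.Automorphic.Liu2021.AppendixC
open Literature.NumberTheory.Automorphic.ShimuraDissection (CosetSpace)
open Literature.Geometry.ComplexHyperbolic Literature.Geometry.ComplexHyperbolic.BallModel
open Literature.AlgebraicGeometry.HodgeTheory (complexBetti)
open Literature.AlgebraicTopology.SingularHomology (singularCohomology)
open Summit.HodgeConjecture.CorCM.Model Summit.HodgeConjecture.CorCM.Model.HComp Summit.HodgeConjecture.CorCM.HComp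
open Summit.HodgeConjecture.CorCM.D2Bridge (albaneseH1Cmp sec42Data_injective_albaneseH1Cmp_of_n_eq_two)

/-! ## §3 (v20)  CLAUSE (1) from the GS source, the curve record systems GIVEN (GS-3-free form) -/

section MainOfCurveRecords

variable {F : CMField} {ι₁ : F →+* ℂ}

set_option maxHeartbeats 2400000 in
-- (measured 2026-08-29 A-p17 g6: statement `whnf` + the F3 `obtain` need > 800 k and ≤ 1.2 M heartbeats; budget = 2 × 1.2 M; the old head's 8 M line is the same proof)
/-- **CLAUSE (1) OF `S34SomeSource` FROM THE GS SEESAW SOURCE — GS-3-FREE FORM.**  Same statement as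
`exists_seesawSourceGS_etPull_comp_ne_zero` with the named fact `hGS3 : exists_recordSystemGS` REPLACED by the hypothesis `hcurve`: for every
`2 + 1` frame `(J⋆, J⊥, B)` of `V.Hm` with `J⊥` totally positive, SOME source threshold `K₀⋆` mapping into `K_f(3)` carries a curve record system
`S⋆` with u1/u4/u2 (relative to THE rank-3 record `recordOf h V h4`).  `hcurve` is what ★ `gsFace_cluster` proves from GS-3 and what the road-(ii)
head GS-3″ (`UnitaryShimuraCurveRecordOfEmbedding`) proves from `exists_recordSystem` alone; the proof is the head's, step (2) abstracted.
[cite: Liu2021, Thm. 4.15 proof p. 51 (FJcycle.tex l. 2185–2213) with fn. 9] [cite: Milne2005ShimuraVarieties, Thm. 13.6 p. 118; Lemma 5.13 p. 57]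
[cite: Deligne1979ShimuraVarieties, Thm. 2.7.20, Cor. 2.7.21, 2.1.2–2.1.4, 2.2.5–2.2.6] -/
theorem exists_seesawSourceGS_etPull_comp_ne_zero_of_curveRecords
    (hMR : ∀ {X' : SchemeOver ℂ} (D' : UnitaryBallUniformisationDatum 2 X'), D'.MR92Prop6Source)
    (hU7 : heckeTranslate_definedOver) (h : exists_recordSystem) (V : HermSpace3 F ι₁) (Φ : CMType F)
    (h4 : 4 ≤ Module.finrank ℚ F) (isoₛ iso : ℕ → Prop)
    (hcurve : ∀ (Jstar : Matrix (Fin 2) (Fin 2) F) (Jperp : Matrix (Fin 1) (Fin 1) F) (B : GL (Fin 3) F)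
      (hB : formCongr ((IsCMField.complexConj F : F ≃ₐ[↥(maximalRealSubfield F)] F) : F →+* F) B ((1 : F) • V.Hm) =
        finSum 2 1 Jstar Jperp) (_ : ∀ τ : F →+* ℂ, 0 < (τ (Jperp 0 0)).re),
      ∃ (K₀ : C5.OpenCompactSubgroup ↥(finAdelic (↥(maximalRealSubfield F)) F (IsCMField.complexConj F) 2 Jstar))
        (S : RecordSystemGS F Jstar ι₁ K₀),
        S.HeckeTranslateDefinedOver ∧ S.IsLevelQuotient ∧
          S.EmbeddingDefinedOver (recordOf h V h4) Jperp B one_ne_zero hB gsFace_re_map_one_pos gsFace_im_map_one ∧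
          K₀.1.map (φGS F Jstar Jperp V.Hm B one_ne_zero hB) ≤ (K3 V).1)
    {ℓ : ℕ} [Fact ℓ.Prime] (X : (sec42DataOfFourLe h V Φ h4 iso).EtaleHeckeDatum ℓ) (ι' : ℂ ≃+* AlgebraicClosure ℚ_[ℓ])
    (hX : X.IsInducedBy (sec42DataOfFourLe_heckeTranslates hU7 h V Φ h4 iso))
    {H : Type} [AddCommGroup H] [Module ℂ H] {rhoB : Representation ℂ (sec42DataOfFourLe h V Φ h4 iso).G H}
    (Bpin : (sec42DataOfFourLe h V Φ h4 iso).BettiPinning (sec42DataOfFourLe_heckeTranslates hU7 h V Φ h4 iso)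
      ((starRingEnd ℂ).comp ι₁) H rhoB)
    {W : Type} [AddCommGroup W] [Module ℂ W] (ρW : Representation ℂ (sec42DataOfFourLe h V Φ h4 iso).G W)
    (f : W →ₛₗ[(ι' : ℂ →+* AlgebraicClosure ℚ_[ℓ])] AlgebraicClosure ℚ_[ℓ] ⊗[ℚ_[ℓ]] (sec42DataOfFourLe h V Φ h4 iso).etaleH1Tower ℓ)
    (hf : f ∈ X.omegaHom ι' ρW) (hf0 : f ≠ 0)
    (Pin : ∀ {P5ₛ : PropC5Data (↥(maximalRealSubfield F)) F} {isoₛ' : ℕ → Prop} (Cₛ : Sec42Data P5ₛ isoₛ'),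
      (Cₛ.G →* (sec42DataOfFourLe h V Φ h4 iso).G) → Prop)
    (mkPin : ∀ (Jstar : Matrix (Fin 2) (Fin 2) F) (Jperp : Matrix (Fin 1) (Fin 1) F) (B : GL (Fin 3) F)
      (hB : formCongr ((IsCMField.complexConj F : F ≃ₐ[↥(maximalRealSubfield F)] F) : F →+* F) B ((1 : F) • V.Hm) =
        finSum 2 1 Jstar Jperp) (_ : ∀ τ : F →+* ℂ, 0 < (τ (Jperp 0 0)).re)
      {K₀ : C5.OpenCompactSubgroup ↥(finAdelic (↥(maximalRealSubfield F)) F (IsCMField.complexConj F) 2 Jstar)}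
      (S : RecordSystemGS F Jstar ι₁ K₀), Pin (sec42DataGS S h4 isoₛ) (φGS F Jstar Jperp V.Hm B one_ne_zero hB)) :
    ∃ (Jstar : Matrix (Fin 2) (Fin 2) F) (Jperp : Matrix (Fin 1) (Fin 1) F) (B : GL (Fin 3) F)
      (hB : formCongr ((IsCMField.complexConj F : F ≃ₐ[↥(maximalRealSubfield F)] F) : F →+* F) B ((1 : F) • V.Hm) = finSum 2 1 Jstar Jperp)
      (hpos : ∀ τ : F →+* ℂ, 0 < (τ (Jperp 0 0)).re)
      (K₀ : C5.OpenCompactSubgroup ↥(finAdelic (↥(maximalRealSubfield F)) F (IsCMField.complexConj F) 2 Jstar))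
      (S : RecordSystemGS F Jstar ι₁ K₀) (hU7ₛ : S.HeckeTranslateDefinedOver)
      (hEmb : S.EmbeddingDefinedOver (recordOf h V h4) Jperp B one_ne_zero hB gsFace_re_map_one_pos gsFace_im_map_one)
      (hLQ : S.IsLevelQuotient)
      (hK₀ : ((sec42DataGS S h4 isoₛ).S.K₀.1 : Subgroup (sec42DataGS S h4 isoₛ).G).map (φGS F Jstar Jperp V.Hm B one_ne_zero hB) ≤
        (sec42DataOfFourLe h V Φ h4 iso).S.K₀.1),
      (((seesawSourceGS S h hU7 V Φ h4 isoₛ iso Jperp B one_ne_zero hB gsFace_re_map_one_pos gsFace_im_map_one hU7ₛ hEmb hLQ ℓ Pin hK₀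
          (mkPin Jstar Jperp B hB hpos S)).M.toEtaleTowerHom.etPull ℓ).baseChange (AlgebraicClosure ℚ_[ℓ])).comp f ≠ 0 := by
  letI inst : Algebra F ℂ := Literature.NumberTheory.Automorphic.Liu2021.AppendixC.algebraAlong F ((starRingEnd ℂ).comp ι₁)
  -- (0) THE TARGET SIDE (F3)
  obtain ⟨Λ, y', g, hg, Xp, ι, hcol, Bq, Jstar, Jperp, B₀, c₁, h7a, hB₀, hpos, hc₁, hdet, hspine⟩ :=
    exists_identityPiece_detectingFrame_of_omegaHom_ne_zero hMR hU7 h V Φ h4 iso X ι' hX Bpin ρW f hf hf0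
  -- (1) E0: the identity-class representative is rational up to the level; the embedding frame `B := γ₁⁻¹ B₀`
  obtain ⟨γ₁, hγ₁⟩ := exists_rep_inv_mul_rational_mem hg
  have hB₀' : formCongr ((IsCMField.complexConj F : F ≃ₐ[↥(maximalRealSubfield F)] F) : F →+* F) B₀ ((1 : F) • V.Hm) =
      finSum 2 1 Jstar Jperp := by
    rw [one_smul, coe_complexConj_eq_conjRingHomK' F]; exact hB₀
  have hB : formCongr ((IsCMField.complexConj F : F ≃ₐ[↥(maximalRealSubfield F)] F) : F →+* F)
      (((γ₁ : GL (Fin 3) F))⁻¹ * B₀) ((1 : F) • V.Hm) = finSum 2 1 Jstar Jperp := by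
    have e := formCongr_mul_of_mem_rational γ₁⁻¹ B₀ (1 : F)
    rw [Subgroup.coe_inv] at e
    exact e.trans hB₀'
  have hBB₀ : (γ₁ : GL (Fin 3) F) * (((γ₁ : GL (Fin 3) F))⁻¹ * B₀) = B₀ := mul_inv_cancel_left _ _
  -- (2) THE CURVE RECORD SYSTEMS, GIVEN (`hcurve`): the source threshold `K₀⋆` and `S⋆` with u1/u4/u2 and `φGS(K₀⋆) ≤ K_f(3)`
  obtain ⟨K₀, Sstar, hU7ₛ, hLQ, hEmb, hK₀⟩ := hcurve Jstar Jperp _ hB hpos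
  refine ⟨Jstar, Jperp, _, hB, hpos, K₀, Sstar, hU7ₛ, hEmb, hLQ, hK₀, ?_⟩
  -- (3) the source detects `cmp_Λ y′` (§2a, record-typed level) and the spine's ∀-clause at `Λ` closes clause (1) for `M := towerHomGS`
  have hdetM := schemeBettiPullAlong_towerHomGS_map_ne_zero Sstar h hU7 V Φ h4 isoₛ iso Jperp (((γ₁ : GL (Fin 3) F))⁻¹ * B₀) one_ne_zero hB
    gsFace_re_map_one_pos gsFace_im_map_one hU7ₛ hEmb Λ hcol
    (Quotient.mk'' (CosetSpace.pt (rationalToFinAdelic _ F _ 3 V.Hm) Λ.1.1 1)) (Bq _) (g _) (h7a _).2.1 (h7a _).2.2.2 γ₁ hγ₁ B₀ hBB₀ c₁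
    hdet (albaneseH1Cmp ((sec42DataOfFourLe h V Φ h4 iso).X Λ) ((sec42DataOfFourLe h V Φ h4 iso).alb Λ) y') hc₁
  exact hspine (towerHomGS Sstar h hU7 V Φ h4 isoₛ iso Jperp _ one_ne_zero hB gsFace_re_map_one_pos gsFace_im_map_one hU7ₛ hEmb)
    (hI_GS Sstar h4 isoₛ ℓ) (sec42Data_injective_albaneseH1Cmp_of_n_eq_two (sec42DataGS Sstar h4 isoₛ) rfl _) hdetM

/-- Sanity junction (old head recovered): GS-3 AT THE FACE (★ `gsFace_cluster` at `K₁ := K⋆(3)`) inhabits `hcurve`; so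
`exists_seesawSourceGS_etPull_comp_ne_zero` = `…_of_curveRecords` at this term.  [cite: Deligne1979ShimuraVarieties, Thm. 2.7.20 (a), Cor. 2.7.21] -/
theorem curveRecords_of_exists_recordSystemGS (hGS3 : exists_recordSystemGS) (h : exists_recordSystem) (V : HermSpace3 F ι₁)
    (h4 : 4 ≤ Module.finrank ℚ F) :
    ∀ (Jstar : Matrix (Fin 2) (Fin 2) F) (Jperp : Matrix (Fin 1) (Fin 1) F) (B : GL (Fin 3) F)
      (hB : formCongr ((IsCMField.complexConj F : F ≃ₐ[↥(maximalRealSubfield F)] F) : F →+* F) B ((1 : F) • V.Hm) =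
        finSum 2 1 Jstar Jperp) (_ : ∀ τ : F →+* ℂ, 0 < (τ (Jperp 0 0)).re),
      ∃ (K₀ : C5.OpenCompactSubgroup ↥(finAdelic (↥(maximalRealSubfield F)) F (IsCMField.complexConj F) 2 Jstar))
        (S : RecordSystemGS F Jstar ι₁ K₀),
        S.HeckeTranslateDefinedOver ∧ S.IsLevelQuotient ∧
          S.EmbeddingDefinedOver (recordOf h V h4) Jperp B one_ne_zero hB gsFace_re_map_one_pos gsFace_im_map_one ∧
          K₀.1.map (φGS F Jstar Jperp V.Hm B one_ne_zero hB) ≤ (K3 V).1 := by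
  intro Jstar Jperp B hB hpos
  let K₁ : C5.OpenCompactSubgroup ↥(finAdelic (↥(maximalRealSubfield F)) F (IsCMField.complexConj F) 2 Jstar) :=
    ⟨finCongruenceLevel (↥(maximalRealSubfield F)) F (IsCMField.complexConj F) 2 Jstar (Ideal.span {(3 : 𝓞 F)}),
      isOpen_finCongruenceLevel (↥(maximalRealSubfield F)) F (IsCMField.complexConj F) 2 Jstar (Level.span_natCast_ne_zero le_rfl),
      isCompact_finCongruenceLevel (↥(maximalRealSubfield F)) F (IsCMField.complexConj F) 2 Jstar (Level.span_natCast_ne_zero le_rfl)⟩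
  obtain ⟨Sstar, hU7ₛ, hLQ, hEmb⟩ := gsFace_cluster V h4 Jstar Jperp B hB hpos K₁ hGS3 h
  exact ⟨_, Sstar, hU7ₛ, hLQ, hEmb, gsFace_hK₀ V Jstar Jperp B hB K₁⟩

end MainOfCurveRecords

/-! ## §4 (v20)  `hcurve` FROM THE ROAD-(ii) HEAD GS-3″ (shape of `UnitaryShimuraCurveRecordOfEmbedding.exists_recordSystemGS_of_recordSystem`):
the F6-side plumbing — hermitian/unit-determinant of `J⋆` from the frame, the (1,1) frame, the injectivity depth `m₀` (★ F-INJ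
`ShimuraSetGS.embPoints_injective_of_le_levelB`), the source threshold `K₀⋆ := K⋆(3) ⊓ φGS⁻¹(K_B((m₀+3)!)) ⊓ φGS⁻¹(K_f(3))` and the field pin
(★ `HComp.RecordSystem.exists_pieces_fieldRange`) — all discharged HERE, so the v20 head keeps the binders of the old one minus `hGS3`. -/

section CurveRecordsOfHead

variable {F : CMField} {ι₁ : F →+* ℂ}

/-- `det J⋆ ≠ 0` from a signature-`(1,1)` frame of `J⋆^{ι₁}` (★ `det_formCongr`). [cite: Kudla1984, §1] -/
theorem gsFace_isUnit_det (Jstar : Matrix (Fin 2) (Fin 2) F) {Tstar : GL (Fin 2) ℂ}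
    (hTstar : formCongr (starRingEnd ℂ) Tstar (Jstar.map ι₁) = Matrix.diagonal ![(1 : ℂ), -1]) : IsUnit Jstar.det := by
  rw [isUnit_iff_ne_zero]
  intro h0
  have h := congrArg Matrix.det hTstar
  have hmap : (Jstar.map ι₁).det = ι₁ Jstar.det := by rw [RingHom.map_det, RingHom.mapMatrix_apply]
  rw [det_formCongr, hmap, h0, map_zero, mul_zero, zero_mul, Matrix.det_diagonal] at h
  norm_num [Fin.prod_univ_two] at h

/-- **`hcurve` from the road-(ii) head.**  From the road-(ii) theorem GS-3″ ★ `exists_recordSystemGS_of_recordSystem` at THE rank-3 record `recordOf h V h4`, the curve record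
systems `hcurve` consumed by `exists_seesawSourceGS_etPull_comp_ne_zero_of_curveRecords` follow: `hJ`/`hdet` from the frame (★ `isHermitian_subform_left`,
`gsFace_isUnit_det`), the (1,1) frame ★ `gsFace_frame`, `m₀` from ★ `ShimuraSetGS.embPoints_injective_of_le_levelB_holds` (R2-1-inj hypothesis-free, A-p15; `det J⊥ ≠ 0` from `hpos ι₁`), the source threshold
`K₀⋆ := K⋆(3) ⊓ φGS⁻¹(K_B((m₀+3)!)) ⊓ φGS⁻¹(K_f(3))` (★ `OpenCompactSubgroup.restrict` twice; `hthr` by `inf` bookkeeping, `hK₀` by ★ `map_restrict_le`),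
and the field pin `hpin` by ★ `HComp.RecordSystem.exists_pieces_fieldRange` (as in F3 :140).
[cite: Deligne1971TravauxShimura, Prop. 1.15] [cite: Milne2005ShimuraVarieties, Thm. 5.16, Thm. 13.6 p. 118] [cite: Deligne1979ShimuraVarieties, 2.2.5–2.2.6] -/
theorem curveRecords_of_head (h : exists_recordSystem) (V : HermSpace3 F ι₁) (h4 : 4 ≤ Module.finrank ℚ F) :
    ∀ (Jstar : Matrix (Fin 2) (Fin 2) F) (Jperp : Matrix (Fin 1) (Fin 1) F) (B : GL (Fin 3) F)
      (hB : formCongr ((IsCMField.complexConj F : F ≃ₐ[↥(maximalRealSubfield F)] F) : F →+* F) B ((1 : F) • V.Hm) =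
        finSum 2 1 Jstar Jperp) (_ : ∀ τ : F →+* ℂ, 0 < (τ (Jperp 0 0)).re),
      ∃ (K₀ : C5.OpenCompactSubgroup ↥(finAdelic ↥(maximalRealSubfield F) F (IsCMField.complexConj F) 2 Jstar)) (S : RecordSystemGS F Jstar ι₁ K₀),
        S.HeckeTranslateDefinedOver ∧ S.IsLevelQuotient ∧
          S.EmbeddingDefinedOver (recordOf h V h4) Jperp B one_ne_zero hB gsFace_re_map_one_pos gsFace_im_map_one ∧
          K₀.1.map (φGS F Jstar Jperp V.Hm B one_ne_zero hB) ≤ (K3 V).1 := by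
  intro Jstar Jperp B hB hpos
  letI : Algebra F ℂ := ι₁.toAlgebra
  -- the frame data of `J⋆`: hermitian, unit determinant, a signature-(1,1) frame at `ι₁`
  obtain ⟨Tstar, hTstar⟩ := gsFace_frame V Jstar Jperp B hB hpos
  have hJ' : (Jstar.map (cmConjRingHom F))ᵀ = Jstar :=
    isHermitian_subform_left (N₁ := 2) (N₂ := 1) (cmConjRingHom F) (IsCMField.complexConj_apply_apply (K := F))
      (gsFace_transpose_map_Hm V) (map_one _) (gsFace_hB_cm V Jstar Jperp B hB)
  have hJ : (Jstar.map (IsCMField.complexConj F))ᵀ = Jstar := by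
    have hc : (⇑(IsCMField.complexConj F) : F → F) = ⇑(cmConjRingHom F) := by
      ext x; rw [← coe_complexConj_eq_conjRingHomK' F]; rfl
    rw [hc]; exact hJ'
  have hdet : IsUnit Jstar.det := gsFace_isUnit_det Jstar hTstar
  -- the injectivity depth `m₀` (★ F-INJ)
  have hJperp : Jperp.det ≠ 0 := by
    rw [Matrix.det_fin_one]
    intro h0
    have h1 := hpos ι₁
    rw [h0, map_zero, Complex.zero_re] at h1
    exact lt_irrefl _ h1
  obtain ⟨m₀, hm₀⟩ := ShimuraSetGS.embPoints_injective_of_le_levelB_holds F V.Hm ι₁ (frameOf V) (formCongr_frameOf V) Jstar Jperp B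
    one_ne_zero hB gsFace_re_map_one_pos gsFace_im_map_one (V.anisotropic_of_four_le h4) V.posDef_of_ne hTstar hJperp
  -- the source threshold `K₀⋆ := K⋆(3) ⊓ φGS⁻¹(K_B((m₀+3)!)) ⊓ φGS⁻¹(K_f(3))`
  let K3s : C5.OpenCompactSubgroup ↥(finAdelic ↥(maximalRealSubfield F) F (IsCMField.complexConj F) 2 Jstar) :=
    ⟨finCongruenceLevel ↥(maximalRealSubfield F) F (IsCMField.complexConj F) 2 Jstar (Ideal.span {(3 : 𝓞 F)}),
      isOpen_finCongruenceLevel ↥(maximalRealSubfield F) F (IsCMField.complexConj F) 2 Jstar (Level.span_natCast_ne_zero le_rfl),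
      isCompact_finCongruenceLevel ↥(maximalRealSubfield F) F (IsCMField.complexConj F) 2 Jstar (Level.span_natCast_ne_zero le_rfl)⟩
  let KB : C5.OpenCompactSubgroup ↥(finAdelic ↥(maximalRealSubfield F) F (IsCMField.complexConj F) 3 V.Hm) :=
    ⟨(finCongruenceLevel ↥(maximalRealSubfield F) F (IsCMField.complexConj F) 3 (finSum 2 1 Jstar Jperp) (Ideal.span {(((m₀ + 3).factorial : ℕ) : 𝓞 F)})).map
        (finAdelicCongr ↥(maximalRealSubfield F) F (IsCMField.complexConj F) B one_ne_zero hB).toMonoidHom,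
      isOpen_levelB F V.Hm Jstar Jperp B one_ne_zero hB m₀, isCompact_levelB F V.Hm Jstar Jperp B one_ne_zero hB m₀⟩
  let K₁ : C5.OpenCompactSubgroup ↥(finAdelic ↥(maximalRealSubfield F) F (IsCMField.complexConj F) 2 Jstar) :=
    C5.OpenCompactSubgroup.restrict (φGS F Jstar Jperp V.Hm B one_ne_zero hB) (continuous_φGS F Jstar Jperp V.Hm B one_ne_zero hB) K3s KB
  let K₀star : C5.OpenCompactSubgroup ↥(finAdelic ↥(maximalRealSubfield F) F (IsCMField.complexConj F) 2 Jstar) :=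
    C5.OpenCompactSubgroup.restrict (φGS F Jstar Jperp V.Hm B one_ne_zero hB) (continuous_φGS F Jstar Jperp V.Hm B one_ne_zero hB) K₁ (K3 V)
  have hthr : K₀star.1 ≤ ((K3 V).1 ⊓ (finCongruenceLevel ↥(maximalRealSubfield F) F (IsCMField.complexConj F) 3 (finSum 2 1 Jstar Jperp)
      (Ideal.span {(((m₀ + 3).factorial : ℕ) : 𝓞 F)})).map (finAdelicCongr ↥(maximalRealSubfield F) F (IsCMField.complexConj F) B one_ne_zero hB).toMonoidHom).comap
      (φGS F Jstar Jperp V.Hm B one_ne_zero hB) := by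
    rw [Subgroup.comap_inf]
    exact le_inf inf_le_right (inf_le_left.trans inf_le_right)
  have hK₀ : K₀star.1.map (φGS F Jstar Jperp V.Hm B one_ne_zero hB) ≤ (K3 V).1 :=
    C5.OpenCompactSubgroup.map_restrict_le _ _ K₁ (K3 V)
  -- the field pin of THE rank-3 record's pieces (Summits ★, as F3 :140)
  have hpin := fun K : C5.SmallLevel (K3 V) =>
    Summit.HodgeConjecture.CorCM.HComp.RecordSystem.exists_pieces_fieldRange _ V.Hm ι₁ (frameOf V) (formCongr_frameOf V) V.isHermitian
      (V.anisotropic_of_four_le h4) V.posDef_of_ne (torsionFree_arithmeticLevel_conj_K3 V) (recordOf h V h4) K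
  obtain ⟨Sstar, hU7ₛ, hLQ, hEmb⟩ := exists_recordSystemGS_of_recordSystem (recordOf h V h4) Jperp B hB gsFace_re_map_one_pos
    gsFace_im_map_one hJ hdet (V.anisotropic_of_four_le h4) hTstar m₀ hm₀ K₀star hthr hpin (hpos ι₁)
  exact ⟨K₀star, Sstar, hU7ₛ, hLQ, hEmb, hK₀⟩

end CurveRecordsOfHead

/-! ## §5 (v20)  THE v20 HEAD: clause (1) from the GS source WITHOUT the GS-3 fact (statement = F6's head minus `hGS3`) -/

section MainV20

variable {F : CMField} {ι₁ : F →+* ℂ}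

/-- **v20 HEAD.** `exists_seesawSourceGS_etPull_comp_ne_zero` with `hGS3` gone: the curve record systems come from the road-(ii) theorem GS-3″
(★ `exists_recordSystemGS_of_recordSystem`) through `curveRecords_of_head`; the binders are EXACTLY F6's head's minus `hGS3`.
[cite: Liu2021, Thm. 4.15 proof p. 51 (FJcycle.tex l. 2185–2213) with fn. 9] [cite: Deligne1979ShimuraVarieties, Thm. 2.7.20, Cor. 2.7.21, 2.2.5–2.2.6] -/
theorem exists_seesawSourceGS_etPull_comp_ne_zero'
    (hMR : ∀ {X' : SchemeOver ℂ} (D' : UnitaryBallUniformisationDatum 2 X'), D'.MR92Prop6Source)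
    (hU7 : heckeTranslate_definedOver) (h : exists_recordSystem) (V : HermSpace3 F ι₁) (Φ : CMType F)
    (h4 : 4 ≤ Module.finrank ℚ F) (isoₛ iso : ℕ → Prop)
    {ℓ : ℕ} [Fact ℓ.Prime] (X : (sec42DataOfFourLe h V Φ h4 iso).EtaleHeckeDatum ℓ) (ι' : ℂ ≃+* AlgebraicClosure ℚ_[ℓ])
    (hX : X.IsInducedBy (sec42DataOfFourLe_heckeTranslates hU7 h V Φ h4 iso))
    {H : Type} [AddCommGroup H] [Module ℂ H] {rhoB : Representation ℂ (sec42DataOfFourLe h V Φ h4 iso).G H}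
    (Bpin : (sec42DataOfFourLe h V Φ h4 iso).BettiPinning (sec42DataOfFourLe_heckeTranslates hU7 h V Φ h4 iso)
      ((starRingEnd ℂ).comp ι₁) H rhoB)
    {W : Type} [AddCommGroup W] [Module ℂ W] (ρW : Representation ℂ (sec42DataOfFourLe h V Φ h4 iso).G W)
    (f : W →ₛₗ[(ι' : ℂ →+* AlgebraicClosure ℚ_[ℓ])] AlgebraicClosure ℚ_[ℓ] ⊗[ℚ_[ℓ]] (sec42DataOfFourLe h V Φ h4 iso).etaleH1Tower ℓ)
    (hf : f ∈ X.omegaHom ι' ρW) (hf0 : f ≠ 0)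
    (Pin : ∀ {P5ₛ : PropC5Data (↥(maximalRealSubfield F)) F} {isoₛ' : ℕ → Prop} (Cₛ : Sec42Data P5ₛ isoₛ'),
      (Cₛ.G →* (sec42DataOfFourLe h V Φ h4 iso).G) → Prop)
    (mkPin : ∀ (Jstar : Matrix (Fin 2) (Fin 2) F) (Jperp : Matrix (Fin 1) (Fin 1) F) (B : GL (Fin 3) F)
      (hB : formCongr ((IsCMField.complexConj F : F ≃ₐ[↥(maximalRealSubfield F)] F) : F →+* F) B ((1 : F) • V.Hm) =
        finSum 2 1 Jstar Jperp) (_ : ∀ τ : F →+* ℂ, 0 < (τ (Jperp 0 0)).re)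
      {K₀ : C5.OpenCompactSubgroup ↥(finAdelic (↥(maximalRealSubfield F)) F (IsCMField.complexConj F) 2 Jstar)}
      (S : RecordSystemGS F Jstar ι₁ K₀), Pin (sec42DataGS S h4 isoₛ) (φGS F Jstar Jperp V.Hm B one_ne_zero hB)) :
    ∃ (Jstar : Matrix (Fin 2) (Fin 2) F) (Jperp : Matrix (Fin 1) (Fin 1) F) (B : GL (Fin 3) F)
      (hB : formCongr ((IsCMField.complexConj F : F ≃ₐ[↥(maximalRealSubfield F)] F) : F →+* F) B ((1 : F) • V.Hm) = finSum 2 1 Jstar Jperp)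
      (hpos : ∀ τ : F →+* ℂ, 0 < (τ (Jperp 0 0)).re)
      (K₀ : C5.OpenCompactSubgroup ↥(finAdelic (↥(maximalRealSubfield F)) F (IsCMField.complexConj F) 2 Jstar))
      (S : RecordSystemGS F Jstar ι₁ K₀) (hU7ₛ : S.HeckeTranslateDefinedOver)
      (hEmb : S.EmbeddingDefinedOver (recordOf h V h4) Jperp B one_ne_zero hB gsFace_re_map_one_pos gsFace_im_map_one)
      (hLQ : S.IsLevelQuotient)
      (hK₀ : ((sec42DataGS S h4 isoₛ).S.K₀.1 : Subgroup (sec42DataGS S h4 isoₛ).G).map (φGS F Jstar Jperp V.Hm B one_ne_zero hB) ≤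
        (sec42DataOfFourLe h V Φ h4 iso).S.K₀.1),
      (((seesawSourceGS S h hU7 V Φ h4 isoₛ iso Jperp B one_ne_zero hB gsFace_re_map_one_pos gsFace_im_map_one hU7ₛ hEmb hLQ ℓ Pin hK₀
          (mkPin Jstar Jperp B hB hpos S)).M.toEtaleTowerHom.etPull ℓ).baseChange (AlgebraicClosure ℚ_[ℓ])).comp f ≠ 0 :=
  exists_seesawSourceGS_etPull_comp_ne_zero_of_curveRecords hMR hU7 h V Φ h4 isoₛ iso (curveRecords_of_head h V h4) X ι' hX
    Bpin ρW f hf hf0 Pin mkPin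

end MainV20

end Summit.HodgeConjecture.CorCM.Lines.A3Liu418

end
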